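import Summits.FinalStateConjecture.FinalStateConjecture.Theorems.BartnikGapSettlingGapExhaustionConditionalExtensionFarTail
import Summits.FinalStateConjecture.FinalStateConjecture.Theorems.BartnikGapSettlingGapExhaustionNodeChartPackage
import Summits.FinalStateConjecture.FinalStateConjecture.Theorems.BartnikGapSettlingGapExhaustionFarChartExtension
import Summits.FinalStateConjecture.FinalStateConjecture.Theorems.BartnikGapSettlingGapExhaustionLabelWindow
import Summits.FinalStateConjecture.FinalStateConjecture.Theorems.BartnikGapSettlingGapExhaustionIKLocalStepTUniform
import Summits.FinalStateConjecture.FinalStateConjecture.Theorems.BartnikGapSettlingGapExhaustionKerrCoordKillingSweepSmoothT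
import Summits.FinalStateConjecture.FinalStateConjecture.Theorems.BartnikGapSettlingGapExhaustionIsMetricOnMetricInCoords
import Summits.FinalStateConjecture.FinalStateConjecture.Theorems.BartnikGapSettlingGapExhaustionKillingCoordBridge
import Literature.Geometry.Lorentzian.KillingFieldLocalExtension
import HarnessLib

/-!
# Crux `GapExhaustion` (stmt-FinalStateConjecture-10808), line `photon-shell-pseudoconvexity`:
# stub ConditionalExtensionFarSilent — S6b‴-far (the far-complete `T`-conditional extension of the
# Hawking field in a STATIONARY eternal near-Kerr star chart, modulo Ionescu–Klainerman's conditional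
# local extension theorem taken as HYPOTHESIS), with the SHARPER hypothesis `FarSilentNearKerr` only

Route `BartnikGapSettling`; `--supports stmt-FinalStateConjecture-10808`, line lead c13 (wave-2).
The landed `conditionalExtensionKStationaryFar_of_IKC` (`…ConditionalExtensionFar.lean`) takes the
node bundle `SilentEternalNearKerr 𝓢 M a Ψ k δ κ₀ t` but uses only its first component, the far/near
silence clause `FarSilentNearKerr 𝓢 M a Ψ k δ` (clock `t` and surface gravity floor `κ₀` untouched).
Here: the same theorem with that weaker hypothesis, proof VERBATIM (constants phase
`Theorems.farChartExtension` / `isCompact_labelWindowGap` / UN-6T `stub_ikLocalStepTU` / UN-2 / §1f;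
per spacetime: pullback, sweep `Theorems.stub_kerrCoordKillingSweepSmoothT` from `c₀ = r_ph⁺ − ε` to
`c₁ ≥ C M + 1` keeping `∂₀ k = 0`, far chain on `{C M / 2 < r < C M}`, then the landed tail
`hawkingPair_of_sweptFarChartFields`) and the bundle-form corollary. [cite: IonescuKlainerman2015, Thm 2.4]
-/

noncomputable section

set_option maxSynthPendingDepth 3

-- D-0017: single-problem summit, `Summit.<S>.<S>.…` by design (cf. lakefile `weak.linter.dupNamespace`).
set_option linter.dupNamespace false

namespace Summit.FinalStateConjecture.FinalStateConjecture.Theorems.PhotonShellNode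

open Literature.Geometry.Lorentzian
open Set Filter
open scoped Manifold ContDiff Topology ENNReal

/-- **S6b‴-far FROM IONESCU–KLAINERMAN'S `T`-CONDITIONAL LOCAL EXTENSION (rev c13; modulo the
hypothesis-shaped named fact `IonescuKlainermanConditionalLocalExtension`), sharper hypothesis: only
the far/near silence clause `FarSilentNearKerr` of the bundle is used.** In a stationary eternal
near-Kerr star chart, a `∂_{t*}`-invariant Hawking Killing field on `V ∪ belowZone (r_ph⁺ − ε)`
extends to a Killing field on `V' ∪ docOfChart` (photon belt, ergoregion AND the whole far region)
with ONE order (`6`) and ONE tolerance over the label window, `V' ⊆ V`. Near part: the conditional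
sweep `Theorems.stub_kerrCoordKillingSweepSmoothT` fed by UN-6T `Theorems.stub_ikLocalStepTU` through
the cylinders `{r = c}`, `r_ph⁺ − ε ≤ c ≤ c₁`, `c₁ ≥ C M + 1`, keeping `∂₀ k = 0`; far part: the far
chain `Theorems.farChartExtension` (universal `C ≥ 16`, `δfar > 0`) on the collar `{C M / 2 < r < C M}`;
then `hawkingPair_of_sweptFarChartFields`. [cite: IonescuKlainerman2015, Thm 2.4] -/
theorem conditionalExtensionKStationaryFarSilent_of_IKC : IonescuKlainermanConditionalLocalExtension →
    ∀ (χ m₀ ε : ℝ), χ < 1 → 0 < m₀ → 0 < ε → ∃ (k : ℕ) (δ : ℝ), 0 < δ ∧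
    ∀ (𝓢 : Spacetime.{0} 4) [𝓢.metric.HasLeviCivita] (M a : ℝ)
      (Ψ : (starBG M a).domain → 𝓢.carrier),
      m₀ ≤ M → M ≤ m₀⁻¹ → |a| ≤ χ * M →
      FarSilentNearKerr 𝓢 M a Ψ k δ →
      Kerr.rPlus M a + 2 * ε ≤ rPhPlus M a →
      ∀ (Φ : E4 → 𝓢.carrier), (∀ x : (starBG M a).domain, Φ x.1 = Ψ x) →
      (∀ z : E4, Kerr.rPlus M a + ε / 4 < Kerr.radius a z → ∀ s : ℝ,
        𝓢.metricInCoords Φ (z + s • E4.basisVector 0) = 𝓢.metricInCoords Φ z) →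
      ∀ (K : Π x : 𝓢.carrier, TangentSpace (𝓡 4) x) (V : Set 𝓢.carrier),
        HawkingPair 𝓢 M a Ψ K V →
        𝓢.metric.toPseudoRiemannianMetric.IsKillingFieldOn K
          (V ∪ belowZone 𝓢 M a Ψ (rPhPlus M a - ε)) →
        (∀ z : E4, Kerr.rPlus M a + ε / 4 < Kerr.radius a z → Kerr.radius a z < rPhPlus M a - ε →
          ∀ s : ℝ, (mfderiv 𝓘(ℝ, E4) (𝓡 4) Φ (z + s • E4.basisVector 0)).inverse
              (K (Φ (z + s • E4.basisVector 0))) =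
            (mfderiv 𝓘(ℝ, E4) (𝓡 4) Φ z).inverse (K (Φ z))) →
      ∃ (K' : Π x : 𝓢.carrier, TangentSpace (𝓡 4) x) (V' : Set 𝓢.carrier),
        HawkingPair 𝓢 M a Ψ K' V' ∧ V' ⊆ V ∧
        𝓢.metric.toPseudoRiemannianMetric.IsKillingFieldOn K' (V' ∪ docOfChart 𝓢 M a Ψ) := by
  intro hIKC χ m₀ ε hχ hm₀ hε
  -- rev c13: the UNIVERSAL far constants `C ≥ 16`, `δfar > 0` of `Theorems.farChartExtension` (p157128)
  obtain ⟨C, δfar, hC16, hδfar, Hfar⟩ := Theorems.farChartExtension (max χ 0) (le_max_right _ _)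
    (max_lt hχ one_pos) hIKC
  -- the compact set of labels of the window at which the shell leaves the gap `r₊ + 2ε ≤ r_ph⁺`
  obtain ⟨Kℓ, hKℓ⟩ : ∃ Kℓ : Set (ℝ × ℝ), Kℓ = {ℓ : ℝ × ℝ | m₀ ≤ ℓ.1 ∧ ℓ.1 ≤ m₀⁻¹ ∧
      |ℓ.2| ≤ χ * ℓ.1 ∧ Kerr.rPlus ℓ.1 ℓ.2 + 2 * ε ≤ Kerr.photonOrbitRadius ℓ.1 (-|ℓ.2|)} := ⟨_, rfl⟩
  have hKc : IsCompact Kℓ := by rw [hKℓ]; exact Theorems.isCompact_labelWindowGap χ m₀ ε hm₀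
  have hlab : ∀ ℓ ∈ Kℓ, 0 < ℓ.1 ∧ |ℓ.2| < ℓ.1 := by
    intro ℓ hℓ
    rw [hKℓ] at hℓ
    obtain ⟨h1, -, h3, -⟩ := hℓ
    have hpos : 0 < ℓ.1 := hm₀.trans_le h1
    have h4 : χ * ℓ.1 < 1 * ℓ.1 := mul_lt_mul_of_pos_right hχ hpos
    exact ⟨hpos, by linarith⟩
  have hgapK : ∀ ℓ ∈ Kℓ, Kerr.rPlus ℓ.1 ℓ.2 + 2 * ε ≤ rPhPlus ℓ.1 ℓ.2 := by
    intro ℓ hℓ; rw [hKℓ] at hℓ; exact hℓ.2.2.2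
  -- the band radii `[r_ph⁺ − ε, max (C ℓ.1 + 1) (r_ph⁺ − ε + 1)]` and the far radius, continuous in the label
  have hrPh : ContinuousOn (fun ℓ : ℝ × ℝ => rPhPlus ℓ.1 ℓ.2) Kℓ :=
    Theorems.continuousOn_rPhPlus₂.mono fun ℓ hℓ ↦ (hlab ℓ hℓ).1
  have hrloc : ContinuousOn (fun ℓ : ℝ × ℝ => rPhPlus ℓ.1 ℓ.2 - ε) Kℓ := hrPh.sub continuousOn_const
  have hrec : ContinuousOn (fun ℓ : ℝ × ℝ => max (C * ℓ.1 + 1) (rPhPlus ℓ.1 ℓ.2 - ε + 1)) Kℓ :=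
    ((continuous_const.mul continuous_fst).add continuous_const).continuousOn.sup
      (hrloc.add continuousOn_const)
  have hRfc : ContinuousOn (fun ℓ : ℝ × ℝ => max (3 * ℓ.1) (max (C * ℓ.1 + 1) (rPhPlus ℓ.1 ℓ.2 - ε + 1) + 2)) Kℓ :=
    ((continuous_const.mul continuous_fst).continuousOn).sup (hrec.add continuousOn_const)
  have hbandK : ∀ ℓ ∈ Kℓ, Kerr.rPlus ℓ.1 ℓ.2 < rPhPlus ℓ.1 ℓ.2 - ε ∧
      rPhPlus ℓ.1 ℓ.2 - ε < max (C * ℓ.1 + 1) (rPhPlus ℓ.1 ℓ.2 - ε + 1) := by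
    intro ℓ hℓ
    have hg := hgapK ℓ hℓ
    exact ⟨by linarith, lt_of_lt_of_le (by linarith) (le_max_right _ _)⟩
  have hε2 : 0 < ε / 2 := by positivity
  have hRf1 : ∀ ℓ ∈ Kℓ, Kerr.rPlus ℓ.1 ℓ.2 + ε / 2 ≤
      max (3 * ℓ.1) (max (C * ℓ.1 + 1) (rPhPlus ℓ.1 ℓ.2 - ε + 1) + 2) := by
    intro ℓ hℓ
    have hg := hgapK ℓ hℓ
    have h1 : Kerr.rPlus ℓ.1 ℓ.2 + ε / 2 ≤ rPhPlus ℓ.1 ℓ.2 - ε + 1 + 2 := by linarith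
    exact (h1.trans (by linarith [le_max_right (C * ℓ.1 + 1) (rPhPlus ℓ.1 ℓ.2 - ε + 1)])).trans (le_max_right _ _)
  have hRf3 : ∀ ℓ ∈ Kℓ, 3 * ℓ.1 ≤ max (3 * ℓ.1) (max (C * ℓ.1 + 1) (rPhPlus ℓ.1 ℓ.2 - ε + 1) + 2) :=
    fun ℓ _ ↦ le_max_left _ _
  -- UN-6T: ONE tolerance `δ₆` and ONE radius map `ρ ↦ ρ'` on the bands
  obtain ⟨δ₆, hδ₆, H6⟩ := Theorems.stub_ikLocalStepTU hIKC Kℓ (fun ℓ => rPhPlus ℓ.1 ℓ.2 - ε)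
    (fun ℓ => max (C * ℓ.1 + 1) (rPhPlus ℓ.1 ℓ.2 - ε + 1)) hKc hlab hrloc hrec hbandK
  -- UN-2 (order 0): ONE tube radius and Lipschitz constant of `r` near the cylinders
  obtain ⟨ρ₀, L₃, ν, CK, hρ₀, hL₃, -, -, hbandU⟩ :=
    Theorems.stub_kerrBandHigherRegularityU Kℓ (fun ℓ => rPhPlus ℓ.1 ℓ.2 - ε)
      (fun ℓ => max (C * ℓ.1 + 1) (rPhPlus ℓ.1 ℓ.2 - ε + 1)) 0 hKc hlab hrloc hrec
      fun ℓ hℓ ↦ ⟨(hbandK ℓ hℓ).1, (hbandK ℓ hℓ).2.le⟩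
  obtain ⟨ρ, hρ⟩ : ∃ ρ : ℝ, ρ = min ρ₀ (min ε 1 / (4 * (L₃ + 1))) := ⟨_, rfl⟩
  have hL₃1 : 0 < L₃ + 1 := by linarith
  have hρpos : 0 < ρ := by
    rw [hρ]; exact lt_min hρ₀ (div_pos (lt_min hε one_pos) (by positivity))
  have hρρ₀ : ρ ≤ ρ₀ := by rw [hρ]; exact min_le_left _ _
  have hρL : ρ ≤ min ε 1 / (4 * (L₃ + 1)) := by rw [hρ]; exact min_le_right _ _
  obtain ⟨ρ', hρ', H6'U⟩ := H6 ρ hρpos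
  -- §1f, uniformly: `η := ε / 2`, far radius `R(ℓ) := max (3 ℓ.1) (r_e(ℓ) + 2)`
  obtain ⟨δd, hδd, HdocU⟩ := farSilent_band_subset_docOfU Kℓ (ε / 2)
    (fun ℓ => max (3 * ℓ.1) (max (C * ℓ.1 + 1) (rPhPlus ℓ.1 ℓ.2 - ε + 1) + 2)) hKc hlab hε2 hRfc hRf1 hRf3
  obtain ⟨δb, hδb, HbzU⟩ := farSilent_band_subset_belowZoneU Kℓ (ε / 2)
    (fun ℓ => max (3 * ℓ.1) (max (C * ℓ.1 + 1) (rPhPlus ℓ.1 ℓ.2 - ε + 1) + 2)) hKc hlab hε2 hRfc hRf1 hRf3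
  obtain ⟨δc, hδc, HchartU⟩ := farSilent_chartPackageU Kℓ hKc hlab
  -- the tolerance (the mass enters only through `max 1 (m₀⁻¹)⁶`)
  obtain ⟨CM, hCM⟩ : ∃ CM : ℝ, CM = max 1 (m₀⁻¹ ^ 6) := ⟨_, rfl⟩
  have hCM1 : 1 ≤ CM := by rw [hCM]; exact le_max_left _ _
  have hCMpos : 0 < CM := one_pos.trans_le hCM1
  have hCMwin : ∀ M : ℝ, m₀ ≤ M → ∀ j : ℕ, j ≤ 6 → (M ^ j)⁻¹ ≤ CM := by
    intro M hM j hj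
    have hMpos : 0 < M := hm₀.trans_le hM
    rcases le_or_gt 1 M with hM1 | hM1
    · exact (inv_le_one_of_one_le₀ (one_le_pow₀ hM1)).trans hCM1
    · rw [hCM]; refine le_trans ?_ (le_max_right _ _)
      rw [← inv_pow]
      have h1 : 1 ≤ M⁻¹ := (one_le_inv₀ hMpos).2 hM1.le
      have h2 : M⁻¹ ≤ m₀⁻¹ := (inv_le_inv₀ hMpos hm₀).2 hM
      exact (pow_le_pow_right₀ h1 hj).trans (pow_le_pow_left₀ (inv_nonneg.2 hMpos.le) h2 6)
  obtain ⟨δ, hδ⟩ : ∃ δ : ℝ, δ = min (min (min δd δb) (min δc (δ₆ / CM))) δfar := ⟨_, rfl⟩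
  have hδpos : 0 < δ := by
    rw [hδ]; exact lt_min (lt_min (lt_min hδd hδb) (lt_min hδc (div_pos hδ₆ hCMpos))) hδfar
  have hδd' : δ ≤ δd := by
    rw [hδ]; exact (min_le_left _ _).trans ((min_le_left _ _).trans (min_le_left _ _))
  have hδb' : δ ≤ δb := by
    rw [hδ]; exact (min_le_left _ _).trans ((min_le_left _ _).trans (min_le_right _ _))
  have hδc' : δ ≤ δc := by
    rw [hδ]; exact (min_le_left _ _).trans ((min_le_right _ _).trans (min_le_left _ _))
  have hδfar' : δ ≤ δfar := by rw [hδ]; exact min_le_right _ _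
  have hδ6' : δ * CM ≤ δ₆ := by
    have h : δ ≤ δ₆ / CM := by
      rw [hδ]; exact (min_le_left _ _).trans ((min_le_right _ _).trans (min_le_right _ _))
    rwa [le_div_iff₀ hCMpos] at h
  refine ⟨6, δ, hδpos, ?_⟩
  intro 𝓢 _ M a Ψ hM hM' ha hFS hgap Φ₀ hΦ₀Ψ hstat₀ K V hKV hKK hKinv₀
  have hMpos : 0 < M := hm₀.trans_le hM
  have ha' : |a| < M := by
    have h1 : χ * M < 1 * M := mul_lt_mul_of_pos_right hχ hMpos
    linarith
  have hrpM : M ≤ Kerr.rPlus M a := le_add_of_nonneg_right (Real.sqrt_nonneg _)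
  have hℓK : (M, a) ∈ Kℓ := by rw [hKℓ]; exact ⟨hM, hM', ha, hgap⟩
  -- the two radii of the sweep and the far radius
  obtain ⟨c₀, hc₀⟩ : ∃ c₀ : ℝ, c₀ = rPhPlus M a - ε := ⟨_, rfl⟩
  obtain ⟨c₁, hc₁⟩ : ∃ c₁ : ℝ, c₁ = max (C * M + 1) (c₀ + 1) := ⟨_, rfl⟩
  have hcase : c₀ < c₁ := by rw [hc₁]; exact lt_of_lt_of_le (by linarith) (le_max_right _ _)
  have hc₀gt : Kerr.rPlus M a + ε ≤ c₀ := by rw [hc₀]; linarith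
  have hc₀pos : 0 < c₀ := by linarith
  have hac₀ : |a| ≤ c₀ := by linarith
  have hCc₁ : C * M + 1 ≤ c₁ := by rw [hc₁]; exact le_max_left _ _
  obtain ⟨R, hR⟩ : ∃ R : ℝ, R = max (3 * M) (c₁ + 2) := ⟨_, rfl⟩
  have hR3 : 3 * M ≤ R := by rw [hR]; exact le_max_left _ _
  have hRc₁ : c₁ + 2 ≤ R := by rw [hR]; exact le_max_right _ _
  -- the uniform facts at the label `(M, a)`
  have H6' := H6'U (M, a) hℓK
  have hband := hbandU (M, a) hℓK
  have Hdoc := HdocU (M, a) hℓK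
  have Hbz := HbzU (M, a) hℓK
  have Hchart := HchartU (M, a) hℓK
  dsimp only at H6' hband Hdoc Hbz Hchart
  rw [← hc₀] at H6' hband Hdoc Hbz
  rw [← hc₁] at H6' hband Hdoc Hbz
  rw [← hR] at Hdoc Hbz
  have hCMj : ∀ j : ℕ, j ≤ 6 → (M ^ j)⁻¹ ≤ CM := hCMwin M hM
  have hRF : 𝓢.metric.toPseudoRiemannianMetric.IsRicciFlat := hFS.1
  have hΨe : Topology.IsOpenEmbedding Ψ := hFS.2.2.1
  obtain ⟨Φ, hΦΨ, hdom, hΦs, hΦe, hΦinj, hinjd, hclose⟩ := Hchart 𝓢 Ψ 6 δ hδpos.le hδc' hFS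
  have hmem : ∀ z : E4, M < Kerr.radius a z → z ∈ ((starBG M a).domain : Set E4) := by
    intro z hz; rw [← hdom]; exact hz
  -- the sets of the construction
  obtain ⟨W, hWdef⟩ : ∃ W : Set E4, W = {z | M < Kerr.radius a z} := ⟨_, rfl⟩
  obtain ⟨D, hDdef⟩ : ∃ D : Set E4,
      D = {y | Kerr.rPlus M a + ε / 2 < Kerr.radius a y ∧ Kerr.radius a y < c₁ + 1} := ⟨_, rfl⟩
  have hW : IsOpen W := by rw [hWdef]; exact isOpen_lt continuous_const (Kerr.continuous_radius a)
  have hD : IsOpen D := by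
    rw [hDdef]
    exact (isOpen_lt continuous_const (Kerr.continuous_radius a)).inter
      (isOpen_lt (Kerr.continuous_radius a) continuous_const)
  have hDW : D ⊆ W := by
    intro y hy; rw [hDdef] at hy; rw [hWdef]; show M < Kerr.radius a y; linarith [hy.1]
  have hltc : ∀ c : ℝ, IsOpen {y : E4 | Kerr.radius a y < c} := fun c ↦
    isOpen_lt (Kerr.continuous_radius a) continuous_const
  have hW₀ : IsOpen (D ∩ {y | Kerr.radius a y < c₀}) := hD.inter (hltc c₀)
  have hW₁ : IsOpen (D ∩ {y | Kerr.radius a y < c₁}) := hD.inter (hltc c₁)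
  have hΦsW : ContMDiffOn 𝓘(ℝ, E4) (𝓡 4) ∞ Φ W := by rw [hWdef]; exact hΦs
  have hinjW : ∀ y ∈ W, Function.Injective (mfderiv 𝓘(ℝ, E4) (𝓡 4) Φ y) := by
    intro y hy; rw [hWdef] at hy; exact hinjd y hy
  have hInjW : InjOn Φ W := by rw [hWdef]; exact hΦinj
  have hGmet : MetricCoord.IsMetricOn (𝓢.metricInCoords Φ) W :=
    Theorems.stub_isMetricOn_metricInCoords 𝓢 Φ W hW hΦsW hinjW
  -- the hypothesis chart `Φ₀` agrees with the package chart `Φ` on the open star domain `W`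
  have heqW : ∀ z ∈ W, Φ₀ z = Φ z := by
    intro z hz; rw [hWdef] at hz; rw [hΦ₀Ψ ⟨z, hmem z hz⟩, hΦΨ ⟨z, hmem z hz⟩]
  have hevW : ∀ z ∈ W, Φ₀ =ᶠ[𝓝 z] Φ := fun z hz ↦
    Filter.eventuallyEq_of_mem (hW.mem_nhds hz) fun y hy ↦ heqW y hy
  have hmic : ∀ z ∈ W, 𝓢.metricInCoords Φ₀ z = 𝓢.metricInCoords Φ z := fun z hz ↦
    𝓢.metricInCoords_congr_of_eventuallyEq (hevW z hz)
  have hmfd : ∀ z ∈ W, mfderiv 𝓘(ℝ, E4) (𝓡 4) Φ₀ z = mfderiv 𝓘(ℝ, E4) (𝓡 4) Φ z := fun z hz ↦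
    (hevW z hz).mfderiv_eq
  have hrad_add : ∀ (z : E4) (s : ℝ), Kerr.radius a (z + s • E4.basisVector 0) = Kerr.radius a z := by
    intro z s
    refine Kerr.radius_eq_of_spatial_eq a ?_
    have h0 : E4.spatial (E4.basisVector 0) = 0 := by ext i; simp
    rw [map_add, map_smul, h0, smul_zero, add_zero]
  have hWε : ∀ z : E4, Kerr.rPlus M a + ε / 4 < Kerr.radius a z → z ∈ W := by
    intro z hz; rw [hWdef]; show M < Kerr.radius a z; linarith
  -- stationarity and `∂₀`-invariance of the Hawking field, read in the package chart
  have hstat : ∀ z : E4, Kerr.rPlus M a + ε / 4 < Kerr.radius a z → ∀ s : ℝ,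
      𝓢.metricInCoords Φ (z + s • E4.basisVector 0) = 𝓢.metricInCoords Φ z := by
    intro z hz s
    have hz' : Kerr.rPlus M a + ε / 4 < Kerr.radius a (z + s • E4.basisVector 0) := by
      rw [hrad_add]; exact hz
    rw [← hmic _ (hWε _ hz'), ← hmic _ (hWε _ hz), hstat₀ z hz s]
  have hKinv : ∀ z : E4, Kerr.rPlus M a + ε / 4 < Kerr.radius a z → Kerr.radius a z < rPhPlus M a - ε →
      ∀ s : ℝ, (mfderiv 𝓘(ℝ, E4) (𝓡 4) Φ (z + s • E4.basisVector 0)).inverse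
          (K (Φ (z + s • E4.basisVector 0))) =
        (mfderiv 𝓘(ℝ, E4) (𝓡 4) Φ z).inverse (K (Φ z)) := by
    intro z hz hz2 s
    have hz' : Kerr.rPlus M a + ε / 4 < Kerr.radius a (z + s • E4.basisVector 0) := by
      rw [hrad_add]; exact hz
    rw [← hmfd _ (hWε _ hz'), ← hmfd _ (hWε _ hz), ← heqW _ (hWε _ hz'), ← heqW _ (hWε _ hz)]
    exact hKinv₀ z hz hz2 s
  -- images of chart points in the node's sets (§1f)
  have himg_bz : ∀ y : E4, Kerr.rPlus M a + ε / 2 < Kerr.radius a y → Kerr.radius a y < c₀ →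
      Φ y ∈ belowZone 𝓢 M a Ψ c₀ := by
    intro y hy1 hy2
    have hyM : M < Kerr.radius a y := by linarith
    have hc₀R : c₀ ≤ R := by linarith
    have h := Hbz 𝓢 Ψ 6 δ (by norm_num) hδb' hFS c₀ hc₀R
    refine h ⟨⟨y, hmem y hyM⟩, ⟨hy1.le, hy2⟩, ?_⟩
    exact (hΦΨ ⟨y, hmem y hyM⟩).symm
  have himg_doc : ∀ y : E4, Kerr.rPlus M a + ε / 2 ≤ Kerr.radius a y → Kerr.radius a y ≤ R →
      Φ y ∈ docOf 𝓢 M a Ψ := by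
    intro y hy1 hy2
    have hyM : M < Kerr.radius a y := by linarith
    have h := Hdoc 𝓢 Ψ 6 δ (by norm_num) hδd' hFS ⟨y, hmem y hyM⟩ hy1 hy2
    rwa [← hΦΨ ⟨y, hmem y hyM⟩] at h
  -- the pulled-back Hawking field: a `∂₀`-invariant coordinate Killing field on `W₀ = D ∩ {r < c₀}`
  have hW₀sub : Φ '' (D ∩ {y | Kerr.radius a y < c₀}) ⊆ V ∪ belowZone 𝓢 M a Ψ (rPhPlus M a - ε) := by
    rintro _ ⟨y, ⟨hyD, hyc⟩, rfl⟩
    rw [hDdef] at hyD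
    refine Or.inr ?_
    rw [← hc₀]; exact himg_bz y hyD.1 hyc
  have hKW₀ : 𝓢.metric.toPseudoRiemannianMetric.IsKillingFieldOn K (Φ '' (D ∩ {y | Kerr.radius a y < c₀})) :=
    hKK.mono hW₀sub
  have hk₀cd : ContDiffOn ℝ ∞ (fun y : E4 => (mfderiv 𝓘(ℝ, E4) (𝓡 4) Φ y).inverse (K (Φ y)))
      (D ∩ {y | Kerr.radius a y < c₀}) :=
    Theorems.stub_contDiffOn_pullbackField 𝓢 Φ _ K hW₀ (hΦsW.mono (inter_subset_left.trans hDW))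
      (fun y hy ↦ hinjW y (hDW hy.1)) hKW₀.1
  have hk₀eq := (Theorems.stub_killingCoord_of_isKillingFieldOn 𝓢 Φ _ K hW₀
    (hΦsW.mono (inter_subset_left.trans hDW)) (fun y hy ↦ hinjW y (hDW hy.1)) hKW₀).2
  have hk₀inv : ∀ y ∈ D ∩ {y | Kerr.radius a y < c₀},
      fderiv ℝ (fun y : E4 => (mfderiv 𝓘(ℝ, E4) (𝓡 4) Φ y).inverse (K (Φ y))) y (E4.basisVector 0) = 0 := by
    intro y hy
    have hyD := hy.1
    rw [hDdef] at hyD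
    have hy4 : Kerr.rPlus M a + ε / 4 < Kerr.radius a y := by linarith [hyD.1]
    have hyc : Kerr.radius a y < rPhPlus M a - ε := by rw [← hc₀]; exact hy.2
    have hd : DifferentiableAt ℝ (fun y : E4 => (mfderiv 𝓘(ℝ, E4) (𝓡 4) Φ y).inverse (K (Φ y))) y :=
      ((hk₀cd y hy).contDiffAt (hW₀.mem_nhds hy)).differentiableAt (by simp)
    exact Theorems.ikStepT_fderiv_eq_zero_of_forall_add_smul hd fun s ↦ hKinv y hy4 hyc s
  -- the `ρ`-balls around the cylinders lie in the arena
  have hballs : ∀ c ∈ Icc c₀ c₁, ∀ x : E4, Kerr.radius a x = c → Metric.ball x ρ ⊆ D := by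
    intro c hc x hx y hy
    rw [Metric.mem_ball, dist_eq_norm] at hy
    have hw : ‖y - x‖ ≤ ρ₀ := hy.le.trans hρρ₀
    obtain ⟨-, hlip, -⟩ := hband x (hx ▸ hc.1) (hx ▸ hc.2) (y - x) hw
    rw [add_sub_cancel, hx] at hlip
    have h1 : L₃ * ‖y - x‖ ≤ L₃ * (min ε 1 / (4 * (L₃ + 1))) :=
      mul_le_mul_of_nonneg_left (hy.le.trans hρL) hL₃
    have h2 : L₃ * (min ε 1 / (4 * (L₃ + 1))) ≤ min ε 1 / 4 := by
      rw [mul_div_assoc']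
      rw [div_le_div_iff₀ (by positivity) (by norm_num)]
      nlinarith [le_min hε.le zero_le_one, min_le_left ε 1]
    have h3 := min_le_left ε 1
    have h4 := min_le_right ε 1
    have h5 := abs_le.1 hlip
    rw [hDdef]
    constructor
    · show Kerr.rPlus M a + ε / 2 < Kerr.radius a y
      linarith [hc.1, h5.1]
    · show Kerr.radius a y < c₁ + 1
      linarith [hc.2, h5.2]
  -- the closeness and stationarity hypotheses of UN-6T on the tube, from the weighted bounds
  have hclose6 : ∀ z : E4, (Kerr.rPlus M a + c₀) / 2 ≤ Kerr.radius a z → Kerr.radius a z ≤ c₁ + 1 →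
      ∀ j : ℕ, j ≤ 6 → ‖iteratedFDeriv ℝ j (fun z => 𝓢.metricInCoords Φ z - Kerr.bilin M a z) z‖ ≤ δ₆ := by
    intro z hz _ j hj
    have hzM : M < Kerr.radius a z := by linarith
    have hr : 0 < Kerr.radius a z := hMpos.trans hzM
    refine (hclose z hzM j hj).trans ?_
    calc δ * M / Kerr.radius a z ^ (j + 1) ≤ δ * M / M ^ (j + 1) := by
          apply div_le_div_of_nonneg_left (by positivity) (by positivity)
          exact pow_le_pow_left₀ hMpos.le hzM.le _
      _ = δ * (M ^ j)⁻¹ := by field_simp; ring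
      _ ≤ δ * CM := mul_le_mul_of_nonneg_left (hCMj j hj) hδpos.le
      _ ≤ δ₆ := hδ6'
  have hstat6 : ∀ z : E4, (Kerr.rPlus M a + c₀) / 2 ≤ Kerr.radius a z → Kerr.radius a z ≤ c₁ + 1 →
      ∀ s : ℝ, 𝓢.metricInCoords Φ (z + s • E4.basisVector 0) = 𝓢.metricInCoords Φ z :=
    fun z hz _ s ↦ hstat z (by linarith) s
  have hloc := H6' 𝓢 Φ hRF hΦs hΦe hinjd hclose6 hstat6
  -- §1g (conditional): the sweep from `c₀` to `c₁ ≥ C M + 1`, carrying `∂₀ k = 0`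
  obtain ⟨kf, hkfcd, hkfeq, hkfinv, hkfagree⟩ := Theorems.stub_kerrCoordKillingSweepSmoothT
    (𝓢.metricInCoords Φ) W D a c₀ c₁ ρ ρ' (E4.basisVector 0)
    (fun y : E4 => (mfderiv 𝓘(ℝ, E4) (𝓡 4) Φ y).inverse (K (Φ y))) hGmet hD hDW hcase.le
    hc₀pos hac₀ hρ' hρpos hballs hloc hk₀cd hk₀eq hk₀inv
  -- rev c13 — THE FAR COMPLETION: `Theorems.farChartExtension` on the collar `{C M / 2 < r < C M}`
  have hrp2 : Kerr.rPlus M a ≤ 2 * M := by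
    have h := Real.sqrt_le_sqrt (show M ^ 2 - a ^ 2 ≤ M ^ 2 by linarith only [sq_nonneg a])
    rw [Real.sqrt_sq hMpos.le] at h
    unfold Kerr.rPlus; linarith
  have hrph3 : rPhPlus M a ≤ 3 * M :=
    (Kerr.photonOrbitRadius_neg_mem hMpos (show -M < -|a| by linarith)
      (by linarith [abs_nonneg a])).2
  have hεM : ε ≤ M := by linarith only [hgap, hrph3, hrpM]
  have h16 : 16 * M ≤ C * M := mul_le_mul_of_nonneg_right hC16 hMpos.le
  have hCMc₁ : C * M < c₁ := by linarith only [hCc₁]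
  have hc₀CM : c₀ < C * M := by rw [hc₀]; linarith only [hrph3, hε, h16, hMpos]
  have hcollar : {y : E4 | C * M / 2 < Kerr.radius a y ∧ Kerr.radius a y < C * M} ⊆
      D ∩ {y | Kerr.radius a y < c₁} := by
    intro y hy
    refine ⟨?_, show Kerr.radius a y < c₁ by linarith only [hy.2, hCMc₁]⟩
    rw [hDdef]
    exact ⟨by linarith only [hy.1, h16, hrp2, hεM, hMpos], by linarith only [hy.2, hCMc₁]⟩
  have haχ' : |a| ≤ max χ 0 * M :=
    ha.trans (mul_le_mul_of_nonneg_right (le_max_left _ _) hMpos.le)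
  obtain ⟨kF, hkFcd, hkFeq, -, hkFagree⟩ := Hfar M a hMpos haχ' 𝓢 Φ hRF hΦs hΦe hinjd
    (fun z hz j hj ↦ (hclose z hz j hj).trans (div_le_div_of_nonneg_right
      (mul_le_mul_of_nonneg_right hδfar' hMpos.le) (pow_nonneg (hMpos.trans hz).le _)))
    (fun z hz s ↦ hstat z (by linarith only [hz, h16, hrp2, hεM, hMpos]) s) kf (hkfcd.mono hcollar)
    (fun y hy ↦ hkfeq y (hcollar hy)) (fun y hy ↦ hkfinv y (hcollar hy))
  -- rev c13: chart-level glue, pushforward N-5 and the Hawking-pair bookkeeping (companion file)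
  exact hawkingPair_of_sweptFarChartFields 𝓢 M a ε C c₀ c₁ R Ψ Φ W D K V kf kF hMpos hε hεM hrp2 h16
    hR3 hc₀ hc₀gt hc₀CM hCMc₁ hWdef hDdef hD hDW hΦΨ hdom hΨe hΦsW hinjW hInjW himg_doc hKV hKK hkfcd
    hkfeq hkfagree hkFcd hkFeq hkFagree

/-- **The bundle form follows (rev c13 wave-2):** the statement of the landed `…Far_of_IKC` (node
bundle `SilentEternalNearKerr … κ₀ t`) from the sharper `FarSilentNearKerr` form, by projection. -/
theorem conditionalExtensionKStationaryFar_of_farSilent :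
    (∀ (χ m₀ ε : ℝ), χ < 1 → 0 < m₀ → 0 < ε → ∃ (k : ℕ) (δ : ℝ), 0 < δ ∧
    ∀ (𝓢 : Spacetime.{0} 4) [𝓢.metric.HasLeviCivita] (M a : ℝ) (Ψ : (starBG M a).domain → 𝓢.carrier),
      m₀ ≤ M → M ≤ m₀⁻¹ → |a| ≤ χ * M → FarSilentNearKerr 𝓢 M a Ψ k δ → Kerr.rPlus M a + 2 * ε ≤ rPhPlus M a →
      ∀ (Φ : E4 → 𝓢.carrier), (∀ x : (starBG M a).domain, Φ x.1 = Ψ x) →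
      (∀ z : E4, Kerr.rPlus M a + ε / 4 < Kerr.radius a z → ∀ s : ℝ,
        𝓢.metricInCoords Φ (z + s • E4.basisVector 0) = 𝓢.metricInCoords Φ z) →
      ∀ (K : Π x : 𝓢.carrier, TangentSpace (𝓡 4) x) (V : Set 𝓢.carrier), HawkingPair 𝓢 M a Ψ K V →
        𝓢.metric.toPseudoRiemannianMetric.IsKillingFieldOn K (V ∪ belowZone 𝓢 M a Ψ (rPhPlus M a - ε)) →
        (∀ z : E4, Kerr.rPlus M a + ε / 4 < Kerr.radius a z → Kerr.radius a z < rPhPlus M a - ε →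
          ∀ s : ℝ, (mfderiv 𝓘(ℝ, E4) (𝓡 4) Φ (z + s • E4.basisVector 0)).inverse
            (K (Φ (z + s • E4.basisVector 0))) = (mfderiv 𝓘(ℝ, E4) (𝓡 4) Φ z).inverse (K (Φ z))) →
      ∃ (K' : Π x : 𝓢.carrier, TangentSpace (𝓡 4) x) (V' : Set 𝓢.carrier), HawkingPair 𝓢 M a Ψ K' V' ∧
        V' ⊆ V ∧ 𝓢.metric.toPseudoRiemannianMetric.IsKillingFieldOn K' (V' ∪ docOfChart 𝓢 M a Ψ)) →
    ∀ (χ κ₀ m₀ ε : ℝ), χ < 1 → 0 < κ₀ → 0 < m₀ → 0 < ε → ∃ (k : ℕ) (δ : ℝ), 0 < δ ∧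
    ∀ (𝓢 : Spacetime.{0} 4) [𝓢.metric.HasLeviCivita] (M a : ℝ) (Ψ : (starBG M a).domain → 𝓢.carrier)
      (t : 𝓢.carrier → ℝ), m₀ ≤ M → M ≤ m₀⁻¹ → |a| ≤ χ * M → SilentEternalNearKerr 𝓢 M a Ψ k δ κ₀ t →
      Kerr.rPlus M a + 2 * ε ≤ rPhPlus M a →
      ∀ (Φ : E4 → 𝓢.carrier), (∀ x : (starBG M a).domain, Φ x.1 = Ψ x) →
      (∀ z : E4, Kerr.rPlus M a + ε / 4 < Kerr.radius a z → ∀ s : ℝ,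
        𝓢.metricInCoords Φ (z + s • E4.basisVector 0) = 𝓢.metricInCoords Φ z) →
      ∀ (K : Π x : 𝓢.carrier, TangentSpace (𝓡 4) x) (V : Set 𝓢.carrier), HawkingPair 𝓢 M a Ψ K V →
        𝓢.metric.toPseudoRiemannianMetric.IsKillingFieldOn K (V ∪ belowZone 𝓢 M a Ψ (rPhPlus M a - ε)) →
        (∀ z : E4, Kerr.rPlus M a + ε / 4 < Kerr.radius a z → Kerr.radius a z < rPhPlus M a - ε →
          ∀ s : ℝ, (mfderiv 𝓘(ℝ, E4) (𝓡 4) Φ (z + s • E4.basisVector 0)).inverse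
            (K (Φ (z + s • E4.basisVector 0))) = (mfderiv 𝓘(ℝ, E4) (𝓡 4) Φ z).inverse (K (Φ z))) →
      ∃ (K' : Π x : 𝓢.carrier, TangentSpace (𝓡 4) x) (V' : Set 𝓢.carrier), HawkingPair 𝓢 M a Ψ K' V' ∧
        V' ⊆ V ∧ 𝓢.metric.toPseudoRiemannianMetric.IsKillingFieldOn K' (V' ∪ docOfChart 𝓢 M a Ψ) := by
  intro hF χ κ₀ m₀ ε hχ _ hm₀ hε; obtain ⟨k, δ, hδ, H⟩ := hF χ m₀ ε hχ hm₀ hε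
  exact ⟨k, δ, hδ, fun 𝓢 _ M a Ψ t hM hM' ha hS ↦ H 𝓢 M a Ψ hM hM' ha hS.1⟩

end Summit.FinalStateConjecture.FinalStateConjecture.Theorems.PhotonShellNode

end
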